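import Summits.CriticalPhenomena.PercolationContinuityZ3.Theorems.SahiBoxTP2Transport
import Summits.CriticalPhenomena.PercolationContinuityZ3.Theorems.SahiBoxTP2PositiveAssociation
import Literature.Probability.LatticeModels.Affiliation
import Mathlib.MeasureTheory.Integral.Layercake

/-!
# Conditioning a box-TP₂ law: cylinders and boxes in the strong set order are stochastically ordered
# (the density-free, infinite-volume form of "FKG lattice condition ⇒ monotonic / strongly positively associated")

Support file of the Sahi cell (`prim-sahi`, typer seat, generation 15; `--supports stmt-CriticalPhenomena-4575`).
Theorems only (no definitions, no named facts, no sorries).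

For a strictly positive probability weight on a FINITE product of two-point chains, Grimmett's Theorem 2.24/2.27
(*The Random-Cluster Model*, §2.2; tree: `Literature/Probability/LatticeModels/HolleyCriterion.lean`, finite
weights) says that the FKG lattice condition implies (indeed is equivalent to) MONOTONICITY — the conditional law
given the configuration `ξ` off a set `F` is stochastically increasing in `ξ` — and STRONG positive association —
every such conditional law is positively associated.  Here is the measure-level statement for the cell's
density-free notion `IsBoxTP2` (total positivity of order two on closed boxes, `SahiBoxTP2Split.lean`), valid for
ARBITRARY (singular, infinite-volume) laws, with conditioning on boxes / cylinders of positive mass: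

* `integral_mul_le_mul_integral_of_upperSets` — layer cake: if two finite measures satisfy
  `ν₁(U) ν₂(Ω) ≤ ν₁(Ω) ν₂(U)` for all measurable up-sets `U`, then `(∫ f dν₁) ν₂(Ω) ≤ ν₁(Ω) ∫ f dν₂` for every
  bounded measurable increasing `f` (unnormalised stochastic domination; no sign condition on `f`).
* `inter_mul_le_of_mIsSetTP2` — ABSTRACT ONE-LINER (any measurable lattice): if `μ` is set-TP₂
  (Müller–Stoyan (ii) / Colangelo–Müller–Scarsini Def. 2, tree `Affiliation.mIsSetTP2`) and `C, C'` are
  measurable with `C ∧ C' ⊆ C`, `C ∨ C' ⊆ C'` (the strong set order), then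
  `μ(U ∩ C) μ(C') ≤ μ(C) μ(U ∩ C')` for every measurable up-set `U`: **conditioning on the larger event
  stochastically increases the law**; `setIntegral_mul_le_of_mIsSetTP2` (function form);
  `mIsSetTP2_restrict_of_supClosed` — the law conditioned on a measurable SUBLATTICE is again set-TP₂.
* `IsBoxTP2.cond_Icc_mono` — THE BOX-TP₂ ENGINE (distributive measurable lattice in which box-TP₂ probability
  measures are positively associated): for boxes `[a₁,b₁] ≤ [a₂,b₂]` (`a₁ ≤ a₂`, `b₁ ≤ b₂`) and every measurable
  up-set `U`, `μ(U ∩ [a₁,b₁]) μ[a₂,b₂] ≤ μ[a₁,b₁] μ(U ∩ [a₂,b₂])` — via positive association of `μ` conditioned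
  on the hull `[a₁,b₂]` (box-TP₂ by `IsBoxTP2.restrict_Icc'`) against the up-set `{≥ a₂}` and the down-set
  `{≤ b₁}`.  Instances: `Q_d` (`…_cube`), the Hilbert cube (`…_hilbert`), `ℝ^d` (`…_real`), with the function
  form `∫_{[a₁,b₁]} f dμ · μ[a₂,b₂] ≤ μ[a₁,b₁] · ∫_{[a₂,b₂]} f dμ`; `{−1,+1}^ι` and the Ising states:
  companion file `SahiIsingConditioning.lean`.

No sorries, no new axioms.
-/

noncomputable section

namespace Summit.CriticalPhenomena.PercolationContinuityZ3.Theorems.SahiBoxTP2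

open MeasureTheory ProbabilityTheory Set Filter Topology Function
open Literature.Probability.LatticeModels Literature.Probability.LatticeModels.Affiliation
open Literature.Probability.Percolation
open scoped ENNReal unitInterval SetFamily

/-! ### From up-sets to increasing functions (layer cake) -/

section Domination

variable {Ω : Type*} [MeasurableSpace Ω] [Preorder Ω]

/-- **Unnormalised stochastic domination, `[0,∞]` form**: if `ν₁(U) ν₂(Ω) ≤ ν₁(Ω) ν₂(U)` for all measurable
up-sets `U`, then `(∫⁻ f dν₁) ν₂(Ω) ≤ ν₁(Ω) (∫⁻ f dν₂)` for every nonnegative measurable increasing `f`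
(layer cake: the super-level sets of `f` are measurable up-sets). [folklore] -/
theorem lintegral_mul_le_mul_lintegral_of_upperSets (ν₁ ν₂ : Measure Ω) [IsFiniteMeasure ν₁]
    [IsFiniteMeasure ν₂]
    (h : ∀ U : Set Ω, IsUpperSet U → MeasurableSet U → ν₁ U * ν₂ univ ≤ ν₁ univ * ν₂ U)
    {f : Ω → ℝ} (hf : Monotone f) (hfm : Measurable f) (hf0 : ∀ x, 0 ≤ f x) :
    (∫⁻ x, ENNReal.ofReal (f x) ∂ν₁) * ν₂ univ ≤ ν₁ univ * ∫⁻ x, ENNReal.ofReal (f x) ∂ν₂ := by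
  rw [lintegral_eq_lintegral_meas_lt ν₁ (Eventually.of_forall hf0) hfm.aemeasurable,
    lintegral_eq_lintegral_meas_lt ν₂ (Eventually.of_forall hf0) hfm.aemeasurable,
    ← lintegral_mul_const' _ _ (measure_ne_top _ _), ← lintegral_const_mul' _ _ (measure_ne_top _ _)]
  exact lintegral_mono fun t => h {a | t < f a} (fun x y hxy hx => lt_of_lt_of_le hx (hf hxy))
    (measurableSet_lt measurable_const hfm)

/-- **Unnormalised stochastic domination for bounded increasing functions**: if two finite measures satisfy
`ν₁(U) ν₂(Ω) ≤ ν₁(Ω) ν₂(U)` for all measurable up-sets `U`, then `(∫ f dν₁) ν₂(Ω) ≤ ν₁(Ω) (∫ f dν₂)` for every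
bounded measurable increasing `f` (any sign: the shift `f + C` cancels).  When `ν₁(Ω) = ν₂(Ω) > 0` this is
`∫ f dν₁ ≤ ∫ f dν₂`. [folklore] -/
theorem integral_mul_le_mul_integral_of_upperSets (ν₁ ν₂ : Measure Ω) [IsFiniteMeasure ν₁]
    [IsFiniteMeasure ν₂]
    (h : ∀ U : Set Ω, IsUpperSet U → MeasurableSet U → ν₁ U * ν₂ univ ≤ ν₁ univ * ν₂ U)
    {f : Ω → ℝ} (hf : Monotone f) (hfm : Measurable f) {C : ℝ} (hfC : ∀ x, |f x| ≤ C) :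
    (∫ x, f x ∂ν₁) * ν₂.real univ ≤ ν₁.real univ * ∫ x, f x ∂ν₂ := by
  set g : Ω → ℝ := fun x => f x + C with hg
  have hg0 : ∀ x, 0 ≤ g x := fun x => by
    have := hfC x
    rw [abs_le] at this
    simp only [hg]
    linarith [this.1]
  have hgC : ∀ x, |g x| ≤ C + C := fun x => by
    have := hfC x
    rw [abs_le] at this
    rw [abs_of_nonneg (hg0 x)]
    simp only [hg]
    linarith [this.2]
  have hgm : Measurable g := hfm.add_const C
  have hgmono : Monotone g := fun x y hxy => by
    show f x + C ≤ f y + C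
    linarith [hf hxy]
  have hgi : ∀ (ν : Measure Ω) [IsFiniteMeasure ν], Integrable g ν := fun ν _ =>
    Integrable.of_bound hgm.aestronglyMeasurable (C + C) (Eventually.of_forall fun x => by
      rw [Real.norm_eq_abs]; exact hgC x)
  have hfi : ∀ (ν : Measure Ω) [IsFiniteMeasure ν], Integrable f ν := fun ν _ =>
    Integrable.of_bound hfm.aestronglyMeasurable C (Eventually.of_forall fun x => by
      rw [Real.norm_eq_abs]; exact hfC x)
  have key := lintegral_mul_le_mul_lintegral_of_upperSets ν₁ ν₂ h hgmono hgm hg0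
  rw [← ofReal_integral_eq_lintegral_ofReal (hgi ν₁) (Eventually.of_forall hg0),
    ← ofReal_integral_eq_lintegral_ofReal (hgi ν₂) (Eventually.of_forall hg0)] at key
  have key' : (∫ x, g x ∂ν₁) * ν₂.real univ ≤ ν₁.real univ * ∫ x, g x ∂ν₂ := by
    have := ENNReal.toReal_mono (ENNReal.mul_ne_top (measure_ne_top _ _) ENNReal.ofReal_ne_top) key
    rwa [ENNReal.toReal_mul, ENNReal.toReal_mul, ENNReal.toReal_ofReal (integral_nonneg hg0),
      ENNReal.toReal_ofReal (integral_nonneg hg0)] at this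
  have e1 : ∫ x, g x ∂ν₁ = ∫ x, f x ∂ν₁ + C * ν₁.real univ := by
    simp only [hg]
    rw [integral_add (hfi ν₁) (integrable_const C), integral_const, smul_eq_mul, mul_comm]
  have e2 : ∫ x, g x ∂ν₂ = ∫ x, f x ∂ν₂ + C * ν₂.real univ := by
    simp only [hg]
    rw [integral_add (hfi ν₂) (integrable_const C), integral_const, smul_eq_mul, mul_comm]
  rw [e1, e2] at key'
  nlinarith [key', measureReal_nonneg (μ := ν₁) (s := univ), measureReal_nonneg (μ := ν₂) (s := univ)]

end Domination

/-! ### The abstract one-liner: set-TP₂ laws and the strong set order -/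

section SetTP2

variable {Ω : Type*} [MeasurableSpace Ω] [Lattice Ω]

/-- **Conditioning a set-TP₂ law on a larger event (strong set order) stochastically increases it**: if
`μ(A)μ(B) ≤ μ(A ∧ B)μ(A ∨ B)` for all measurable `A, B` and `C ∧ C' ⊆ C`, `C ∨ C' ⊆ C'`, then for every
measurable up-set `U`, `μ(U ∩ C) μ(C') ≤ μ(C) μ(U ∩ C')` — because `(U ∩ C) ∧ C' ⊆ C` and
`(U ∩ C) ∨ C' ⊆ U ∩ C'`.  (The printed remark "an MTP₂ measure is always CI", tree
`condIncrGiven_of_mIsSetTP2`, is the case of two cylinders `A < B`.) [this work] -/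
theorem inter_mul_le_of_mIsSetTP2 {μ : Measure Ω} (hμ : mIsSetTP2 μ) {C C' : Set Ω} (hC : MeasurableSet C)
    (hC' : MeasurableSet C') (hinf : C ⊼ C' ⊆ C) (hsup : C ⊻ C' ⊆ C') {U : Set Ω} (hU : IsUpperSet U)
    (hUm : MeasurableSet U) : μ (U ∩ C) * μ C' ≤ μ C * μ (U ∩ C') := by
  have h1 : (U ∩ C) ⊼ C' ⊆ C := fun z hz => by
    obtain ⟨x, hx, y, hy, rfl⟩ := Set.mem_infs.1 hz
    exact hinf (Set.mem_infs.2 ⟨x, hx.2, y, hy, rfl⟩)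
  have h2 : (U ∩ C) ⊻ C' ⊆ U ∩ C' := fun z hz => by
    obtain ⟨x, hx, y, hy, rfl⟩ := Set.mem_sups.1 hz
    exact ⟨hU le_sup_left hx.1, hsup (Set.mem_sups.2 ⟨x, hx.2, y, hy, rfl⟩)⟩
  calc μ (U ∩ C) * μ C' ≤ μ ((U ∩ C) ⊼ C') * μ ((U ∩ C) ⊻ C') := hμ (hUm.inter hC) hC'
    _ ≤ μ C * μ (U ∩ C') := mul_le_mul' (measure_mono h1) (measure_mono h2)

/-- **Function form**: under the same hypotheses, `(∫_C f dμ) μ(C') ≤ μ(C) ∫_{C'} f dμ` for every bounded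
measurable increasing `f` — i.e. `E[f | C] ≤ E[f | C']` whenever both events have positive mass. [this work] -/
theorem setIntegral_mul_le_of_mIsSetTP2 {μ : Measure Ω} [IsFiniteMeasure μ] (hμ : mIsSetTP2 μ) {C C' : Set Ω}
    (hC : MeasurableSet C) (hC' : MeasurableSet C') (hinf : C ⊼ C' ⊆ C) (hsup : C ⊻ C' ⊆ C') {f : Ω → ℝ}
    (hf : Monotone f) (hfm : Measurable f) {B : ℝ} (hfB : ∀ x, |f x| ≤ B) :
    (∫ x in C, f x ∂μ) * μ.real C' ≤ μ.real C * ∫ x in C', f x ∂μ := by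
  have key := integral_mul_le_mul_integral_of_upperSets (μ.restrict C) (μ.restrict C') (fun U hU hUm => ?_)
    hf hfm hfB
  · rwa [measureReal_restrict_apply_univ, measureReal_restrict_apply_univ] at key
  · rw [Measure.restrict_apply hUm, Measure.restrict_apply hUm, Measure.restrict_apply_univ,
      Measure.restrict_apply_univ]
    exact inter_mul_le_of_mIsSetTP2 hμ hC hC' hinf hsup hU hUm

/-- **The law conditioned on a measurable sublattice is again set-TP₂** (`(A ∩ L) ∧ (B ∩ L) ⊆ (A ∧ B) ∩ L`).
[this work] -/
theorem mIsSetTP2_restrict_of_supClosed {μ : Measure Ω} (hμ : mIsSetTP2 μ) {L : Set Ω} (hL : MeasurableSet L)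
    (hLs : SupClosed L) (hLi : InfClosed L) : mIsSetTP2 (μ.restrict L) := by
  intro A B hA hB
  rw [Measure.restrict_apply' hL, Measure.restrict_apply' hL, Measure.restrict_apply' hL,
    Measure.restrict_apply' hL]
  have h1 : (A ∩ L) ⊼ (B ∩ L) ⊆ (A ⊼ B) ∩ L := fun z hz => by
    obtain ⟨x, hx, y, hy, rfl⟩ := Set.mem_infs.1 hz
    exact ⟨Set.mem_infs.2 ⟨x, hx.1, y, hy.1, rfl⟩, hLi hx.2 hy.2⟩
  have h2 : (A ∩ L) ⊻ (B ∩ L) ⊆ (A ⊻ B) ∩ L := fun z hz => by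
    obtain ⟨x, hx, y, hy, rfl⟩ := Set.mem_sups.1 hz
    exact ⟨Set.mem_sups.2 ⟨x, hx.1, y, hy.1, rfl⟩, hLs hx.2 hy.2⟩
  calc μ (A ∩ L) * μ (B ∩ L) ≤ μ ((A ∩ L) ⊼ (B ∩ L)) * μ ((A ∩ L) ⊻ (B ∩ L)) := hμ (hA.inter hL) (hB.inter hL)
    _ ≤ μ ((A ⊼ B) ∩ L) * μ ((A ⊻ B) ∩ L) := mul_le_mul' (measure_mono h1) (measure_mono h2)

end SetTP2

section LatticeOnly

variable {Ω : Type*} [Lattice Ω]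

/-- Boxes in the strong set order: for `a₁ ≤ a₂`, `b₁ ≤ b₂`, `[a₁,b₁] ∧ [a₂,b₂] ⊆ [a₁,b₁]`. [folklore] -/
theorem Icc_infs_Icc_subset {a₁ b₁ a₂ b₂ : Ω} (ha : a₁ ≤ a₂) (hb : b₁ ≤ b₂) :
    Icc a₁ b₁ ⊼ Icc a₂ b₂ ⊆ Icc a₁ b₁ := by
  have _ := hb
  refine Set.infs_subset_iff.2 fun x hx y hy => ⟨le_inf hx.1 (ha.trans hy.1), inf_le_left.trans hx.2⟩

/-- Boxes in the strong set order: for `a₁ ≤ a₂`, `b₁ ≤ b₂`, `[a₁,b₁] ∨ [a₂,b₂] ⊆ [a₂,b₂]`. [folklore] -/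
theorem Icc_sups_Icc_subset {a₁ b₁ a₂ b₂ : Ω} (ha : a₁ ≤ a₂) (hb : b₁ ≤ b₂) :
    Icc a₁ b₁ ⊻ Icc a₂ b₂ ⊆ Icc a₂ b₂ := by
  have _ := ha
  refine Set.sups_subset_iff.2 fun x hx y hy => ⟨hy.1.trans le_sup_right, sup_le (hx.2.trans hb) hy.2⟩

/-- A closed box is a sublattice. [folklore] -/
theorem supClosed_Icc' (a b : Ω) : SupClosed (Icc a b) := fun _ hx _ hy =>
  ⟨hx.1.trans le_sup_left, sup_le hx.2 hy.2⟩

/-- A closed box is a sublattice. [folklore] -/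
theorem infClosed_Icc' (a b : Ω) : InfClosed (Icc a b) := fun _ hx _ hy =>
  ⟨le_inf hx.1 hy.1, inf_le_left.trans hx.2⟩

end LatticeOnly

/-! ### The box-TP₂ engine: positive association of the law conditioned on the hull box -/

section Engine

variable {Ω : Type*} [MeasurableSpace Ω] [DistribLattice Ω]

/-- Restriction of a box-TP₂ measure to a closed box is box-TP₂ (topology-free variant of
`IsBoxTP2.restrict_Icc`: measurability of boxes as a hypothesis). [folklore] -/
theorem IsBoxTP2.restrict_Icc' (hIcc : ∀ a b : Ω, MeasurableSet (Icc a b)) {μ : Measure Ω} (hμ : IsBoxTP2 μ)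
    (p q : Ω) : IsBoxTP2 (μ.restrict (Icc p q)) := by
  have hI : ∀ a b : Ω, Icc a b ∩ Icc p q = Icc (a ⊔ p) (b ⊓ q) := fun a b => Icc_inter_Icc
  intro a b a' b'
  rw [Measure.restrict_apply (hIcc _ _), Measure.restrict_apply (hIcc _ _), Measure.restrict_apply (hIcc _ _),
    Measure.restrict_apply (hIcc _ _), hI, hI, hI, hI]
  have key := hμ (a ⊔ p) (b ⊓ q) (a' ⊔ p) (b' ⊓ q)
  rwa [← sup_inf_right, ← inf_inf_distrib_right, ← sup_sup_distrib_right, ← inf_sup_right] at key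

/-- Cancelling a positive finite normalisation: `(M⁻¹x)(M⁻¹y) ≤ M⁻¹z ⇒ xy ≤ zM`. [folklore] -/
theorem mul_le_mul_of_inv_smul {M x y z : ℝ≥0∞} (hM0 : M ≠ 0) (hMt : M ≠ ∞)
    (h : M⁻¹ * x * (M⁻¹ * y) ≤ M⁻¹ * z) : x * y ≤ z * M := by
  calc x * y = (M * M⁻¹) * x * ((M * M⁻¹) * y) := by rw [ENNReal.mul_inv_cancel hM0 hMt, one_mul, one_mul]
    _ = M * M * (M⁻¹ * x * (M⁻¹ * y)) := by ring
    _ ≤ M * M * (M⁻¹ * z) := mul_le_mul_right h _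
    _ = (M * M⁻¹) * (z * M) := by ring
    _ = z * M := by rw [ENNReal.mul_inv_cancel hM0 hMt, one_mul]

/-- Cancelling a positive finite normalisation: `M⁻¹z ≤ (M⁻¹x)(M⁻¹y) ⇒ zM ≤ xy`. [folklore] -/
theorem mul_le_mul_of_inv_smul' {M x y z : ℝ≥0∞} (hM0 : M ≠ 0) (hMt : M ≠ ∞)
    (h : M⁻¹ * z ≤ M⁻¹ * x * (M⁻¹ * y)) : z * M ≤ x * y := by
  calc z * M = (M * M⁻¹) * (z * M) := by rw [ENNReal.mul_inv_cancel hM0 hMt, one_mul]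
    _ = M * M * (M⁻¹ * z) := by ring
    _ ≤ M * M * (M⁻¹ * x * (M⁻¹ * y)) := mul_le_mul_right h _
    _ = (M * M⁻¹) * x * ((M * M⁻¹) * y) := by ring
    _ = x * y := by rw [ENNReal.mul_inv_cancel hM0 hMt, one_mul, one_mul]

/-- **Unnormalised positive association of a box-TP₂ law conditioned on a box**: in a distributive measurable
lattice in which box-TP₂ probability measures are positively associated, for a finite box-TP₂ measure `μ`, a box
`B = [p,q]` and measurable up-sets `U, V`: `μ(U ∩ B) μ(V ∩ B) ≤ μ(U ∩ V ∩ B) μ(B)`. [this work] -/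
theorem IsBoxTP2.upper_inter_Icc_mul_le (hIcc : ∀ a b : Ω, MeasurableSet (Icc a b))
    (hPA : ∀ ν : Measure Ω, IsProbabilityMeasure ν → IsBoxTP2 ν → IsPositivelyAssociated ν)
    {μ : Measure Ω} [IsFiniteMeasure μ] (hμ : IsBoxTP2 μ) (p q : Ω) {U V : Set Ω} (hU : IsUpperSet U)
    (hV : IsUpperSet V) (hUm : MeasurableSet U) (hVm : MeasurableSet V) :
    μ (U ∩ Icc p q) * μ (V ∩ Icc p q) ≤ μ (U ∩ V ∩ Icc p q) * μ (Icc p q) := by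
  set B := Icc p q with hB
  by_cases hM0 : μ B = 0
  · rw [measure_inter_null_of_null_right U hM0, zero_mul]
    exact zero_le
  have hMt : μ B ≠ ∞ := measure_ne_top _ _
  set ν : Measure Ω := (μ B)⁻¹ • μ.restrict B with hν
  have hνapp : ∀ {S : Set Ω}, MeasurableSet S → ν S = (μ B)⁻¹ * μ (S ∩ B) := fun hS => by
    rw [hν, Measure.smul_apply, smul_eq_mul, Measure.restrict_apply hS]
  haveI : IsProbabilityMeasure ν := ⟨by
    rw [hνapp MeasurableSet.univ, univ_inter, ENNReal.inv_mul_cancel hM0 hMt]⟩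
  have hνtp : IsBoxTP2 ν := (hμ.restrict_Icc' hIcc p q).smul _
  have key := (hPA ν inferInstance hνtp).mul_le_inter hU hV hUm hVm
  rw [hνapp hUm, hνapp hVm, hνapp (hUm.inter hVm)] at key
  exact mul_le_mul_of_inv_smul hM0 hMt key

/-- **Unnormalised negative correlation of an up-set and a down-set under a box-TP₂ law conditioned on a box**:
`μ(U ∩ D ∩ B) μ(B) ≤ μ(U ∩ B) μ(D ∩ B)` for `U` upper, `D` lower, `B = [p,q]`. [this work] -/
theorem IsBoxTP2.upper_inter_lower_inter_Icc_mul_le (hIcc : ∀ a b : Ω, MeasurableSet (Icc a b))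
    (hPA : ∀ ν : Measure Ω, IsProbabilityMeasure ν → IsBoxTP2 ν → IsPositivelyAssociated ν)
    {μ : Measure Ω} [IsFiniteMeasure μ] (hμ : IsBoxTP2 μ) (p q : Ω) {U D : Set Ω} (hU : IsUpperSet U)
    (hD : IsLowerSet D) (hUm : MeasurableSet U) (hDm : MeasurableSet D) :
    μ (U ∩ D ∩ Icc p q) * μ (Icc p q) ≤ μ (U ∩ Icc p q) * μ (D ∩ Icc p q) := by
  set B := Icc p q with hB
  by_cases hM0 : μ B = 0
  · rw [hM0, mul_zero]
    exact zero_le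
  have hMt : μ B ≠ ∞ := measure_ne_top _ _
  set ν : Measure Ω := (μ B)⁻¹ • μ.restrict B with hν
  have hνapp : ∀ {S : Set Ω}, MeasurableSet S → ν S = (μ B)⁻¹ * μ (S ∩ B) := fun hS => by
    rw [hν, Measure.smul_apply, smul_eq_mul, Measure.restrict_apply hS]
  haveI : IsProbabilityMeasure ν := ⟨by
    rw [hνapp MeasurableSet.univ, univ_inter, ENNReal.inv_mul_cancel hM0 hMt]⟩
  have hνtp : IsBoxTP2 ν := (hμ.restrict_Icc' hIcc p q).smul _
  have key := (hPA ν inferInstance hνtp).upperSet_lowerSet hU hD hUm hDm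
  rw [hνapp hUm, hνapp hDm, hνapp (hUm.inter hDm)] at key
  exact mul_le_mul_of_inv_smul' hM0 hMt key

/-- **Boxes in the strong set order are stochastically ordered under a box-TP₂ law** (the engine): for
`a₁ ≤ a₂`, `b₁ ≤ b₂` and every measurable up-set `U`,
`μ(U ∩ [a₁,b₁]) μ[a₂,b₂] ≤ μ[a₁,b₁] μ(U ∩ [a₂,b₂])`.  Proof: condition on the hull `B = [a₁,b₂]`; the smaller
box is `B ∩ {≤ b₁}` (a down-set), the larger is `B ∩ {≥ a₂}` (an up-set); positive association of `μ(· | B)`.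
[this work] -/
theorem IsBoxTP2.cond_Icc_mono (hIcc : ∀ a b : Ω, MeasurableSet (Icc a b))
    (hIci : ∀ a : Ω, MeasurableSet (Ici a)) (hIic : ∀ b : Ω, MeasurableSet (Iic b))
    (hPA : ∀ ν : Measure Ω, IsProbabilityMeasure ν → IsBoxTP2 ν → IsPositivelyAssociated ν)
    {μ : Measure Ω} [IsFiniteMeasure μ] (hμ : IsBoxTP2 μ) {a₁ b₁ a₂ b₂ : Ω} (ha : a₁ ≤ a₂) (hb : b₁ ≤ b₂)
    {U : Set Ω} (hU : IsUpperSet U) (hUm : MeasurableSet U) :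
    μ (U ∩ Icc a₁ b₁) * μ (Icc a₂ b₂) ≤ μ (Icc a₁ b₁) * μ (U ∩ Icc a₂ b₂) := by
  have e1 : Icc a₁ b₁ = Iic b₁ ∩ Icc a₁ b₂ := Set.ext fun x =>
    ⟨fun hx => ⟨hx.2, hx.1, hx.2.trans hb⟩, fun hx => ⟨hx.2.1, hx.1⟩⟩
  have e2 : Icc a₂ b₂ = Ici a₂ ∩ Icc a₁ b₂ := Set.ext fun x =>
    ⟨fun hx => ⟨hx.1, ha.trans hx.1, hx.2⟩, fun hx => ⟨hx.1, hx.2.2⟩⟩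
  have top := hμ.upper_inter_Icc_mul_le hIcc hPA a₁ b₂ hU (isUpperSet_Ici a₂) hUm (hIci a₂)
  have bot := hμ.upper_inter_lower_inter_Icc_mul_le hIcc hPA a₁ b₂ hU (isLowerSet_Iic b₁) hUm (hIic b₁)
  rw [inter_assoc, ← e2] at top
  rw [inter_assoc, ← e1] at bot
  -- `top : μ(U ∩ B) μ[a₂,b₂] ≤ μ(U ∩ [a₂,b₂]) μ B`, `bot : μ(U ∩ [a₁,b₁]) μ B ≤ μ(U ∩ B) μ[a₁,b₁]`, `B = [a₁,b₂]`
  by_cases hM0 : μ (Icc a₁ b₂) = 0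
  · have : μ (Icc a₂ b₂) = 0 := measure_mono_null (by rw [e2]; exact inter_subset_right) hM0
    rw [this, mul_zero]
    exact zero_le
  have hMt : μ (Icc a₁ b₂) ≠ ∞ := measure_ne_top _ _
  rw [← ENNReal.mul_le_mul_iff_left hM0 hMt]
  calc μ (U ∩ Icc a₁ b₁) * μ (Icc a₂ b₂) * μ (Icc a₁ b₂)
      = μ (U ∩ Icc a₁ b₁) * μ (Icc a₁ b₂) * μ (Icc a₂ b₂) := by ring
    _ ≤ μ (U ∩ Icc a₁ b₂) * μ (Icc a₁ b₁) * μ (Icc a₂ b₂) := by gcongr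
    _ = μ (Icc a₁ b₁) * (μ (U ∩ Icc a₁ b₂) * μ (Icc a₂ b₂)) := by ring
    _ ≤ μ (Icc a₁ b₁) * (μ (U ∩ Icc a₂ b₂) * μ (Icc a₁ b₂)) := by gcongr
    _ = μ (Icc a₁ b₁) * μ (U ∩ Icc a₂ b₂) * μ (Icc a₁ b₂) := by ring

/-- **Function form of the engine**: `(∫_{[a₁,b₁]} f dμ) μ[a₂,b₂] ≤ μ[a₁,b₁] ∫_{[a₂,b₂]} f dμ` for every bounded
measurable increasing `f`, i.e. `E[f | a₁ ≤ X ≤ b₁] ≤ E[f | a₂ ≤ X ≤ b₂]` when both boxes have positive mass.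
[this work] -/
theorem IsBoxTP2.setIntegral_Icc_mono (hIcc : ∀ a b : Ω, MeasurableSet (Icc a b))
    (hIci : ∀ a : Ω, MeasurableSet (Ici a)) (hIic : ∀ b : Ω, MeasurableSet (Iic b))
    (hPA : ∀ ν : Measure Ω, IsProbabilityMeasure ν → IsBoxTP2 ν → IsPositivelyAssociated ν)
    {μ : Measure Ω} [IsFiniteMeasure μ] (hμ : IsBoxTP2 μ) {a₁ b₁ a₂ b₂ : Ω} (ha : a₁ ≤ a₂) (hb : b₁ ≤ b₂)
    {f : Ω → ℝ} (hf : Monotone f) (hfm : Measurable f) {C : ℝ} (hfC : ∀ x, |f x| ≤ C) :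
    (∫ x in Icc a₁ b₁, f x ∂μ) * μ.real (Icc a₂ b₂) ≤ μ.real (Icc a₁ b₁) * ∫ x in Icc a₂ b₂, f x ∂μ := by
  have key := integral_mul_le_mul_integral_of_upperSets (μ.restrict (Icc a₁ b₁)) (μ.restrict (Icc a₂ b₂))
    (fun U hU hUm => ?_) hf hfm hfC
  · rwa [measureReal_restrict_apply_univ, measureReal_restrict_apply_univ] at key
  · rw [Measure.restrict_apply hUm, Measure.restrict_apply hUm, Measure.restrict_apply_univ,
      Measure.restrict_apply_univ]
    exact hμ.cond_Icc_mono hIcc hIci hIic hPA ha hb hU hUm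

/-- **The conditioned law is positively associated (strong positive association)**, unnormalised:
`μ(U ∩ V ∩ B) μ(B) ≥ μ(U ∩ B) μ(V ∩ B)` is `IsBoxTP2.upper_inter_Icc_mul_le`; normalised form for a box of
positive mass. [this work] -/
theorem IsBoxTP2.isPositivelyAssociated_cond_Icc (hIcc : ∀ a b : Ω, MeasurableSet (Icc a b))
    (hPA : ∀ ν : Measure Ω, IsProbabilityMeasure ν → IsBoxTP2 ν → IsPositivelyAssociated ν)
    {μ : Measure Ω} (hμ : IsBoxTP2 μ) {p q : Ω} (h0 : μ (Icc p q) ≠ 0) (ht : μ (Icc p q) ≠ ∞) :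
    IsPositivelyAssociated ((μ (Icc p q))⁻¹ • μ.restrict (Icc p q)) := by
  haveI : IsProbabilityMeasure ((μ (Icc p q))⁻¹ • μ.restrict (Icc p q)) := ⟨by
    rw [Measure.smul_apply, smul_eq_mul, Measure.restrict_apply_univ, ENNReal.inv_mul_cancel h0 ht]⟩
  exact hPA _ inferInstance ((hμ.restrict_Icc' hIcc p q).smul _)

end Engine

/-! ### Instances: the unit cube, the Hilbert cube, `ℝ^d` -/

section Instances

variable {d : ℕ}

/-- **`Q_d`: boxes in the strong set order are stochastically ordered under a box-TP₂ law.** [this work] -/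
theorem IsBoxTP2.cond_Icc_mono_cube (μ : Measure (Fin d → I)) [IsFiniteMeasure μ] (hμ : IsBoxTP2 μ)
    {a₁ b₁ a₂ b₂ : Fin d → I} (ha : a₁ ≤ a₂) (hb : b₁ ≤ b₂) {U : Set (Fin d → I)} (hU : IsUpperSet U)
    (hUm : MeasurableSet U) : μ (U ∩ Icc a₁ b₁) * μ (Icc a₂ b₂) ≤ μ (Icc a₁ b₁) * μ (U ∩ Icc a₂ b₂) :=
  hμ.cond_Icc_mono (fun _ _ => measurableSet_Icc) (fun _ => measurableSet_Ici) (fun _ => measurableSet_Iic)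
    (fun ν _ hν => hν.isPositivelyAssociated_cube ν) ha hb hU hUm

/-- `Q_d`, function form: `(∫_{[a₁,b₁]} f dμ) μ[a₂,b₂] ≤ μ[a₁,b₁] ∫_{[a₂,b₂]} f dμ`. [this work] -/
theorem IsBoxTP2.setIntegral_Icc_mono_cube (μ : Measure (Fin d → I)) [IsFiniteMeasure μ] (hμ : IsBoxTP2 μ)
    {a₁ b₁ a₂ b₂ : Fin d → I} (ha : a₁ ≤ a₂) (hb : b₁ ≤ b₂) {f : (Fin d → I) → ℝ} (hf : Monotone f)
    (hfm : Measurable f) {C : ℝ} (hfC : ∀ x, |f x| ≤ C) :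
    (∫ x in Icc a₁ b₁, f x ∂μ) * μ.real (Icc a₂ b₂) ≤ μ.real (Icc a₁ b₁) * ∫ x in Icc a₂ b₂, f x ∂μ :=
  hμ.setIntegral_Icc_mono (fun _ _ => measurableSet_Icc) (fun _ => measurableSet_Ici)
    (fun _ => measurableSet_Iic) (fun ν _ hν => hν.isPositivelyAssociated_cube ν) ha hb hf hfm hfC

/-- **The Hilbert cube `[0,1]^ℕ`: boxes in the strong set order are stochastically ordered under a box-TP₂ law.**
[this work] -/
theorem IsBoxTP2.cond_Icc_mono_hilbert (μ : Measure (ℕ → I)) [IsFiniteMeasure μ] (hμ : IsBoxTP2 μ)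
    {a₁ b₁ a₂ b₂ : ℕ → I} (ha : a₁ ≤ a₂) (hb : b₁ ≤ b₂) {U : Set (ℕ → I)} (hU : IsUpperSet U)
    (hUm : MeasurableSet U) : μ (U ∩ Icc a₁ b₁) * μ (Icc a₂ b₂) ≤ μ (Icc a₁ b₁) * μ (U ∩ Icc a₂ b₂) :=
  hμ.cond_Icc_mono (fun _ _ => measurableSet_Icc) (fun _ => measurableSet_Ici) (fun _ => measurableSet_Iic)
    (fun ν _ hν => hν.isPositivelyAssociated_hilbert ν) ha hb hU hUm

/-- Hilbert cube, function form. [this work] -/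
theorem IsBoxTP2.setIntegral_Icc_mono_hilbert (μ : Measure (ℕ → I)) [IsFiniteMeasure μ] (hμ : IsBoxTP2 μ)
    {a₁ b₁ a₂ b₂ : ℕ → I} (ha : a₁ ≤ a₂) (hb : b₁ ≤ b₂) {f : (ℕ → I) → ℝ} (hf : Monotone f)
    (hfm : Measurable f) {C : ℝ} (hfC : ∀ x, |f x| ≤ C) :
    (∫ x in Icc a₁ b₁, f x ∂μ) * μ.real (Icc a₂ b₂) ≤ μ.real (Icc a₁ b₁) * ∫ x in Icc a₂ b₂, f x ∂μ :=
  hμ.setIntegral_Icc_mono (fun _ _ => measurableSet_Icc) (fun _ => measurableSet_Ici)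
    (fun _ => measurableSet_Iic) (fun ν _ hν => hν.isPositivelyAssociated_hilbert ν) ha hb hf hfm hfC

/-- **`ℝ^d`: boxes in the strong set order are stochastically ordered under a box-TP₂ law** (e.g. box-truncations
of a Gaussian vector with M-matrix precision). [this work] -/
theorem IsBoxTP2.cond_Icc_mono_real (μ : Measure (Fin d → ℝ)) [IsFiniteMeasure μ] (hμ : IsBoxTP2 μ)
    {a₁ b₁ a₂ b₂ : Fin d → ℝ} (ha : a₁ ≤ a₂) (hb : b₁ ≤ b₂) {U : Set (Fin d → ℝ)} (hU : IsUpperSet U)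
    (hUm : MeasurableSet U) : μ (U ∩ Icc a₁ b₁) * μ (Icc a₂ b₂) ≤ μ (Icc a₁ b₁) * μ (U ∩ Icc a₂ b₂) :=
  hμ.cond_Icc_mono (fun _ _ => measurableSet_Icc) (fun _ => measurableSet_Ici) (fun _ => measurableSet_Iic)
    (fun ν _ hν => hν.isPositivelyAssociated_real ν) ha hb hU hUm

/-- `ℝ^d`, function form. [this work] -/
theorem IsBoxTP2.setIntegral_Icc_mono_real (μ : Measure (Fin d → ℝ)) [IsFiniteMeasure μ] (hμ : IsBoxTP2 μ)
    {a₁ b₁ a₂ b₂ : Fin d → ℝ} (ha : a₁ ≤ a₂) (hb : b₁ ≤ b₂) {f : (Fin d → ℝ) → ℝ} (hf : Monotone f)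
    (hfm : Measurable f) {C : ℝ} (hfC : ∀ x, |f x| ≤ C) :
    (∫ x in Icc a₁ b₁, f x ∂μ) * μ.real (Icc a₂ b₂) ≤ μ.real (Icc a₁ b₁) * ∫ x in Icc a₂ b₂, f x ∂μ :=
  hμ.setIntegral_Icc_mono (fun _ _ => measurableSet_Icc) (fun _ => measurableSet_Ici)
    (fun _ => measurableSet_Iic) (fun ν _ hν => hν.isPositivelyAssociated_real ν) ha hb hf hfm hfC

end Instances

end Summit.CriticalPhenomena.PercolationContinuityZ3.Theorems.SahiBoxTP2
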